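import Literature.Computability.Complexity.SpaceQueryMachine
import Literature.Computability.Complexity.SpaceLoopBounded
import HarnessLib

/-!
# The query transducer of a space machine: trajectory and space

Second half of `SpaceQueryMachine.lean` (the query transducer `SpaceQuery.queryTM N` of an
input-preserving space machine `N : SpaceMachine Bool Bool`; Homer–Selman 2011, Thm. 5.10 /
Cor. 5.7 and proof of Prop. 7.5: a space-bounded decider is re-run in place to answer a query).
Here:

* `SpaceQuery.answerFn A` — the string function computed: `0 q ↦ 0 [q ∈ A] q`, every other
  word fixed;
* `SpaceQuery.runsVia_query` — the complete trajectory on an input `0 q` when `N` decides `A` in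
  space `Sf` (`DecidesInSpace`, `Space.lean`): `test`, `mvQ`, `feedN`, the run of `N` on `q`,
  `testN`, `restore`, `mvN`, `pourBack`, `clear`, ending in Mathlib's `haltList` normal form with
  `0 [q ∈ A] q` on `IO`, through configurations of total stack length `≤ C + 2` whenever
  `Sf q + |q| ≤ C` (the stacks of `N` hold its work space plus, on its two input stacks, the
  query: `SpaceQuery.stkLen_eq_workSpace_add`);
* `SpaceQuery.runsVia_answerFn`, `SpaceQuery.spaceRuns_answerFn` — for every input word, in the
  total-stack-length form `SpaceLoop.SpaceRuns (queryTM N) _ _ (answerFn A) (n ↦ n + 2 + S n)`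
  of `SpaceLoopBounded.lean`, for any monotone `S` dominating `Sf` (the bridge from the work-space
  bound of `PSPACE` deciders to the total-stack-length accounting of `SpaceLoop`: total =
  work space + input, `R n = n + S n + 2`).

## References

* S. Homer, A. L. Selman, *Computability and Complexity Theory*, 2nd ed., Springer 2011,
  Thm. 5.10, Cor. 5.7, proof of Prop. 7.5 (`NP^PSPACE = PSPACE`). [HomerSelman2011]
* S. Arora, B. Barak, *Computational Complexity: A Modern Approach*, CUP 2009, Def. 4.1 (work
  space vs. read-only input), §4.1. [AroraBarak2009]
-/

noncomputable section

namespace Literature.Computability.Complexity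

namespace SpaceQuery

open Turing StateTransition Function TM2Comp SpaceLoop _root_.Computability

/-! ### The function computed by the query transducer -/

/-- **The answer function** of a language `A`: a query word `0 q` is answered in place,
`0 q ↦ 0 [q ∈ A] q`; words not of this form (the empty word, flagged words `1 w`) are returned
unchanged. [cite: HomerSelman2011, proof of Prop. 7.5 (answering the oracle queries of NP^PSPACE by a PSPACE computation)] -/
def answerFn (A : Language Bool) : List Bool → List Bool
  | false :: q => false :: A.boolIndicator q :: q
  | w => w

variable (A : Language Bool)

/-- `answerFn` on a query word. [folklore] -/
@[simp] theorem answerFn_false (q : List Bool) :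
    answerFn A (false :: q) = false :: A.boolIndicator q :: q := rfl

/-- `answerFn` on a flagged word. [folklore] -/
@[simp] theorem answerFn_true (r : List Bool) : answerFn A (true :: r) = true :: r := rfl

/-- `answerFn` on the empty word. [folklore] -/
@[simp] theorem answerFn_nil : answerFn A [] = [] := rfl

/-- `answerFn` lengthens a word by at most one symbol. [folklore] -/
theorem length_answerFn_le (w : List Bool) : (answerFn A w).length ≤ w.length + 1 := by
  rcases w with _ | ⟨_ | _, w⟩ <;> simp

/-! ### Total stack length of the query transducer -/

variable (N : SpaceMachine Bool Bool)

/-- The total stack length of a configuration of the query transducer, split as (stacks of `N`)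
+ `IO` + `TMP`. [folklore] -/
def qLen (c : QCfg N) : ℕ :=
  stkLen N.tm (fun k => c.stk (Sum.inl k)) + (c.stk (Sum.inr QAux.IO)).length +
    (c.stk (Sum.inr QAux.TMP)).length

/-- `qLen` of an explicit configuration. [folklore] -/
@[simp] theorem qLen_mk (l : Option (N.tm.Λ ⊕ QCtrl)) (var : QSt N.tm.σ) (S : ∀ k, List (N.tm.Γ k))
    (io t : List Bool) : qLen N ⟨l, var, mkStk S io t⟩ = stkLen N.tm S + io.length + t.length := rfl

/-- `qLen` of a `cfg`. [folklore] -/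
@[simp] theorem qLen_cfg (l : Option (N.tm.Λ ⊕ QCtrl)) (s : N.tm.σ) (S : ∀ k, List (N.tm.Γ k))
    (io t : List Bool) : qLen N (cfg N l s S io t) = stkLen N.tm S + io.length + t.length := rfl

/-- `qLen` of an embedded configuration of `N`. [folklore] -/
@[simp] theorem qLen_cfgN (c : N.tm.Cfg) : qLen N (cfgN c) = stkLen N.tm c.stk := by
  simp [qLen, cfgN, stkLen]

/-- The total stack length of the bundled query transducer, split as (stacks of `N`) + `IO` +
`TMP` (so that on a configuration `c` it is `qLen N c`). [folklore] -/
theorem stkLen_queryTM (S : ∀ j, List (QΓ N.tm.Γ j)) :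
    stkLen (queryTM N) S = stkLen N.tm (fun k => S (Sum.inl k)) + (S (Sum.inr QAux.IO)).length +
      (S (Sum.inr QAux.TMP)).length := by
  letI := N.tm.kFin
  change (∑ j : N.tm.K ⊕ QAux, (S j).length) =
    (∑ k : N.tm.K, (S (Sum.inl k)).length) + (S (Sum.inr QAux.IO)).length +
      (S (Sum.inr QAux.TMP)).length
  rw [Fintype.sum_sum_type]
  have h : (Finset.univ : Finset QAux) = {QAux.IO, QAux.TMP} := by
    ext a; cases a <;> simp
  rw [h, Finset.sum_pair (by decide)]
  ring

/-- **Total stack length of a space machine = work space + the two input stacks.**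
[cite: AroraBarak2009, Def. 4.1 (only the work tapes are charged)] -/
theorem stkLen_eq_workSpace_add (c : N.tm.Cfg) :
    stkLen N.tm c.stk = N.workSpace c + (c.stk N.tm.k₀).length + (c.stk N.kL).length := by
  letI := N.tm.kFin
  unfold stkLen SpaceMachine.workSpace
  have h1 := Finset.sum_erase_add (Finset.univ.erase N.tm.k₀) (fun k => (c.stk k).length)
    (a := N.kL) (Finset.mem_erase.2 ⟨N.kL_ne_k₀, Finset.mem_univ _⟩)
  have h2 := Finset.sum_erase_add Finset.univ (fun k => (c.stk k).length) (a := N.tm.k₀)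
    (Finset.mem_univ _)
  omega

/-- Pointwise shorter stacks have smaller total length. [folklore] -/
theorem stkLen_mono {S S' : ∀ k, List (N.tm.Γ k)} (h : ∀ k, (S' k).length ≤ (S k).length) :
    stkLen N.tm S' ≤ stkLen N.tm S := by
  letI := N.tm.kFin
  exact Finset.sum_le_sum fun k _ => h k

/-! ### Initial and halting configurations -/

/-- The initial configuration of the query transducer on `w`. [folklore] -/
theorem initList_queryTM (w : List Bool) :
    initList (queryTM N) w = cfg N (some (Sum.inr QCtrl.test)) N.tm.initialState (botStk N.tm) w [] := by
  rw [initList_eq]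
  change (⟨some (Sum.inr QCtrl.test), (N.tm.initialState, none),
      update (fun j => ([] : List (QΓ N.tm.Γ j))) (Sum.inr QAux.IO) w⟩ : QCfg N) = _
  rw [← mkStk_bot_IO]
  rfl

/-- The halting configuration of the query transducer with output `w`. [folklore] -/
theorem haltList_queryTM (w : List Bool) :
    haltList (queryTM N) w = cfg N none N.tm.initialState (botStk N.tm) w [] := by
  rw [haltList_eq]
  change (⟨none, (N.tm.initialState, none),
      update (fun j => ([] : List (QΓ N.tm.Γ j))) (Sum.inr QAux.IO) w⟩ : QCfg N) = _
  rw [← mkStk_bot_IO]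
  rfl

/-! ### The trajectory on a query word -/

/-- **The trajectory of the query transducer on a query word `0 q`.** If `N` decides `A` in
space `Sf` (`DecidesInSpace`: input preserving, halting with `[q ∈ A]` on its output stack, work
space `≤ Sf q`) and `Sf q + |q| ≤ C`, then from `test` with `0 q` on `IO` the transducer reaches
the halting configuration with `0 [q ∈ A] q` on `IO`, all other stacks empty and the state reset,
through configurations of total stack length `≤ C + 2`.
[cite: HomerSelman2011, Thm. 5.10 and proof of Prop. 7.5 (one oracle query answered by re-running the space-bounded decider in place)] -/
theorem runsVia_query {A : Language Bool} {Sf : List Bool → ℕ} (hN : DecidesInSpace N A Sf)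
    {C : ℕ} (q : List Bool) (hC : Sf q + q.length ≤ C) :
    RunsVia (C := QCfg N) (queryTM N).step (fun c => qLen N c ≤ C + 2)
      (cfg N (some (Sum.inr QCtrl.test)) N.tm.initialState (botStk N.tm) (false :: q) [])
      (cfg N none N.tm.initialState (botStk N.tm) (false :: A.boolIndicator q :: q) []) := by
  set P : QCfg N → Prop := fun c => qLen N c ≤ C + 2 with hP
  set b := A.boolIndicator q with hb
  have hne : N.tm.k₀ ≠ N.kL := N.kL_ne_k₀.symm
  obtain ⟨hpres, hdec⟩ := hN
  obtain ⟨⟨c, hc⟩, hspace⟩ := hdec q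
  obtain ⟨hreach, hstep⟩ := StateTransition.mem_eval.1 hc.1
  obtain ⟨n, hn⟩ := exists_iterate_of_reaches hreach
  -- space of the configurations of `N` reachable from `N.init q`
  have hmid : ∀ d : N.tm.Cfg, Reaches N.tm.step (N.init q) d → stkLen N.tm d.stk ≤ C := by
    intro d hd
    have h1 := hspace d hd
    have h2 := congrArg List.length (hpres q d hd)
    simp only [List.length_append, List.length_reverse, List.length_map] at h2
    rw [stkLen_eq_workSpace_add]
    omega
  -- the halting configuration of `N`
  obtain ⟨l, v, S'⟩ := c
  have hl : l = none := by
    cases l with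
    | none => rfl
    | some l => simp [FinTM2.step, TM2.step] at hstep
  subst hl
  have hpc : ((S' N.kL).map N.leftAlphabet).reverse ++ (S' N.tm.k₀).map N.inputAlphabet = q :=
    hpres q _ hreach
  have hlen : (S' N.kL).length + (S' N.tm.k₀).length = q.length := by
    have := congrArg List.length hpc
    simp only [List.length_append, List.length_reverse, List.length_map] at this
    omega
  have hC' : stkLen N.tm S' ≤ C := hmid _ hreach
  have hk₁ : (S' N.tm.k₁).head? = some (N.outputAlphabet.symm b) := by
    have h := hc.2
    change (S' N.tm.k₁).map N.outputAlphabet = encodeBool b at h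
    cases hS : S' N.tm.k₁ with
    | nil => rw [hS] at h; simp [encodeBool] at h
    | cons g L =>
      rw [hS] at h
      simp only [List.map_cons, encodeBool, List.pure_def, List.cons.injEq, List.map_eq_nil_iff] at h
      simp [← h.1]
  -- phase 1: `test`
  have e1 := step_test_false N N.tm.initialState (botStk N.tm) q []
  have hP0 : P (cfg N (some (Sum.inr QCtrl.test)) N.tm.initialState (botStk N.tm) (false :: q) []) := by
    simp [hP]; omega
  -- phase 2: `mvQ`
  have h2 := mvQ_run N P N.tm.initialState (botStk N.tm) q []
    (fun i₁ i₂ h => by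
      have := congrArg List.length h
      simp only [List.length_append] at this
      simp [hP]; omega)
    (by simp [hP]; omega)
  simp only [List.append_nil] at h2
  -- phase 3: `feedN`
  have h3 := feedN_run N P N.tm.initialState [] q.reverse (botStk N.tm)
    (fun t₁ t₂ h => by
      have := congrArg List.length h
      simp only [List.length_append, List.length_reverse] at this
      simp [hP]; omega)
    (by simp [hP]; omega)
  have e3 : cfg N (some (Sum.inl N.tm.main)) N.tm.initialState
      (update (botStk N.tm) N.tm.k₀ (q.reverse.reverse.map N.inputAlphabet.symm ++ botStk N.tm N.tm.k₀)) [] [] =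
      cfgN (N.init q) := by
    simp only [List.reverse_reverse, List.append_nil, cfg, cfgN, SpaceMachine.init, initList_eq,
      Option.elim_some]
  rw [e3] at h3
  -- phase 4: the run of `N`
  have h4 := runN N P hn (fun j hj d hd => by
    simp only [hP, qLen_cfgN]
    exact (hmid d (reaches_of_iterate_flip_bind _ _ _ _ hd)).trans (by omega))
  have e4 : cfgN (⟨none, v, S'⟩ : N.tm.Cfg) = cfg N (some (Sum.inr QCtrl.testN)) v S' [] [] := rfl
  rw [e4] at h4
  -- phase 5: `testN`
  have e5 := step_testN N v S' [] [] (N.outputAlphabet.symm b) hk₁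
  simp only [Equiv.apply_symm_apply] at e5
  have hP5 : P (cfg N (some (Sum.inr QCtrl.restore)) v S' [] [b]) := by
    simp [hP]; omega
  -- phase 6: `restore` (the space of these configurations: symbols only move from `kL` to `k₀`)
  have hsp6 : ∀ L₁ L₂ : List (N.tm.Γ N.kL), L₁ ++ L₂ = S' N.kL →
      stkLen N.tm (update (update S' N.kL L₂) N.tm.k₀
        ((L₁.map fun g => N.inputAlphabet.symm (N.leftAlphabet g)).reverse ++ S' N.tm.k₀)) =
        stkLen N.tm S' := by
    intro L₁ L₂ h
    have ha := stkLen_update N.tm S' N.kL L₂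
    have hb' := stkLen_update N.tm (update S' N.kL L₂) N.tm.k₀
      ((L₁.map fun g => N.inputAlphabet.symm (N.leftAlphabet g)).reverse ++ S' N.tm.k₀)
    rw [update_of_ne hne] at hb'
    have hl := congrArg List.length h
    simp only [List.length_append, List.length_reverse, List.length_map] at hb' hl
    omega
  have h6 := restore_run N P v [] [b] (S' N.kL) S'
    (fun L₁ L₂ h => by
      have := hsp6 L₁ L₂ h
      simp only [hP, qLen_cfg, List.length_nil, List.length_singleton]
      omega)
    (by
      have := hsp6 (S' N.kL) [] (List.append_nil _)
      simp only [hP, qLen_cfg, List.length_nil, List.length_singleton]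
      omega)
  rw [update_eq_self] at h6
  set S₆ : ∀ k, List (N.tm.Γ k) :=
    update (update S' N.kL []) N.tm.k₀
      (((S' N.kL).map fun g => N.inputAlphabet.symm (N.leftAlphabet g)).reverse ++ S' N.tm.k₀) with hS₆
  have hq₆ : (S₆ N.tm.k₀).map N.inputAlphabet = q := by
    rw [hS₆, update_self, List.map_append, List.map_reverse, List.map_map]
    have : (N.inputAlphabet ∘ fun g => N.inputAlphabet.symm (N.leftAlphabet g)) = N.leftAlphabet := by
      funext g; simp
    rw [this, hpc]
  have hlen₆ : (S₆ N.tm.k₀).length = q.length := by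
    rw [← hq₆, List.length_map]
  have hstk₆ : stkLen N.tm S₆ = stkLen N.tm S' := by
    have := hsp6 (S' N.kL) [] (List.append_nil _)
    rw [← hS₆] at this
    omega
  -- phase 7: `mvN`
  have h7 := mvN_run N P v S₆ [] (S₆ N.tm.k₀) [b]
    (fun L₁ L₂ h => by
      simp only [hP, qLen_cfg, List.length_nil, List.length_append, List.length_reverse,
        List.length_map, List.length_singleton]
      have ha := stkLen_update N.tm S₆ N.tm.k₀ L₂
      have hl := congrArg List.length h
      simp only [List.length_append] at hl
      omega)
    (by
      simp only [hP, qLen_cfg, List.length_nil, List.length_append, List.length_reverse,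
        List.length_map, List.length_singleton]
      have ha := stkLen_update N.tm S₆ N.tm.k₀ []
      simp only [List.length_nil] at ha
      omega)
  rw [update_eq_self, hq₆] at h7
  set S₇ : ∀ k, List (N.tm.Γ k) := update S₆ N.tm.k₀ [] with hS₇
  have hstk₇ : stkLen N.tm S₇ + q.length = stkLen N.tm S' := by
    have ha := stkLen_update N.tm S₆ N.tm.k₀ []
    rw [← hS₇, hlen₆] at ha
    simp only [List.length_nil] at ha
    omega
  -- phase 8: `pourBack`
  have h8 := pourBack_run N P v S₇ (q.reverse ++ [b]) []
    (fun t₁ t₂ h => by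
      simp only [hP, qLen_cfg, List.length_append, List.length_reverse, List.length_nil]
      have hl := congrArg List.length h
      simp only [List.length_append, List.length_reverse, List.length_singleton] at hl
      omega)
    (by
      simp only [hP, qLen_cfg, List.length_cons, List.length_append, List.length_reverse,
        List.length_nil]
      omega)
  simp only [List.reverse_append, List.reverse_singleton, List.reverse_reverse, List.singleton_append,
    List.append_nil] at h8
  -- phase 9: `clear`
  have h9 := clear_run N P v S₇ (false :: b :: q) []
    (fun S'' hS'' => by
      simp only [hP, qLen_cfg, List.length_cons, List.length_nil]
      have := stkLen_mono N hS''
      omega)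
    (by simp [hP]; omega)
  -- assembling the phases
  refine RunsVia.step_trans e1 hP0 (h2.trans (h3.trans (h4.trans ?_)))
  exact RunsVia.step_trans e5 h4.last (h6.trans (h7.trans (h8.trans h9)))

/-! ### The query transducer computes `answerFn` in bounded space -/

/-- **The query transducer computes `answerFn A`**, from `initList` to `haltList`, through
configurations of total stack length `≤ |w| + 2 + S |w|`, for any monotone `S` dominating the
space bound of `N`. [cite: HomerSelman2011, Thm. 5.10 and proof of Prop. 7.5] -/
theorem runsVia_answerFn {A : Language Bool} {Sf : List Bool → ℕ} (hN : DecidesInSpace N A Sf)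
    (S : ℕ → ℕ) (hS : Monotone S) (hSf : ∀ q, Sf q ≤ S q.length) (w : List Bool) :
    RunsVia (C := QCfg N) (queryTM N).step (fun c => qLen N c ≤ w.length + 2 + S w.length)
      (initList (queryTM N) w) (haltList (queryTM N) (answerFn A w)) := by
  rw [initList_queryTM, haltList_queryTM]
  rcases w with _ | ⟨_ | _, q⟩
  · exact RunsVia.single (step_test_nil N N.tm.initialState (botStk N.tm) [])
      (by simp only [qLen_cfg, stkLen_bot, List.length_nil]; omega)
      (by simp only [answerFn_nil, qLen_cfg, stkLen_bot, List.length_nil]; omega)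
  · -- a query word `0 q`
    have hC : Sf q + q.length ≤ q.length + S (q.length + 1) := by
      have := (hSf q).trans (hS (Nat.le_add_right q.length 1)); omega
    refine (runsVia_query N hN q hC).mono fun c hc => ?_
    simp only [List.length_cons] at hc ⊢
    omega
  · exact RunsVia.single (step_test_true N N.tm.initialState (botStk N.tm) q [])
      (by simp only [qLen_cfg, stkLen_bot, List.length_cons, List.length_nil]; omega)
      (by simp only [answerFn_true, qLen_cfg, stkLen_bot, List.length_cons, List.length_nil]; omega)

/-- The query transducer with its (identity) input and output alphabet identifications, as a
`Turing.TM2ComputableAux Bool Bool` (so that it composes by `Turing.TM2ComputableAux.comp`).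
[folklore] -/
def queryAux : TM2ComputableAux Bool Bool where
  tm := queryTM N
  inputAlphabet := Equiv.refl Bool
  outputAlphabet := Equiv.refl Bool

/-- The same in the form `SpaceLoop.SpaceRuns` (total stack length of the bundled machine, input
and output written through the identity alphabet identifications of `queryAux`).
[cite: HomerSelman2011, Thm. 5.10 and proof of Prop. 7.5] -/
theorem spaceRuns_answerFn {A : Language Bool} {Sf : List Bool → ℕ} (hN : DecidesInSpace N A Sf)
    (S : ℕ → ℕ) (hS : Monotone S) (hSf : ∀ q, Sf q ≤ S q.length) :
    SpaceRuns (queryAux N).tm (queryAux N).inputAlphabet (queryAux N).outputAlphabet (answerFn A)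
      (fun n => n + 2 + S n) := by
  intro w
  have e₀ : List.map (⇑(queryAux N).inputAlphabet.symm) w = w := by
    show List.map (⇑(Equiv.refl Bool).symm) w = w
    simp
  have e₁ : List.map (⇑(queryAux N).outputAlphabet.symm) (answerFn A w) = answerFn A w := by
    show List.map (⇑(Equiv.refl Bool).symm) (answerFn A w) = answerFn A w
    simp
  rw [e₀, e₁]
  exact (runsVia_answerFn N hN S hS hSf w).mono fun c hc => (stkLen_queryTM N c.stk).trans_le hc

end SpaceQuery

end Literature.Computability.Complexity

end
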